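import Literature.Geometry.Lorentzian.NonImprisonmentProofs
import Literature.Geometry.Lorentzian.CauchyDevelopmentGlobalHyperbolicityProofs
import Summits.FinalStateConjecture.FinalStateConjecture.Theorems.BondiDrainDispersalHorizonlessMustDrainNoHorizonOfFutureNullComplete
import HarnessLib

/-!
# No single viewpoint sees a whole maximal causal geodesic (helper for crux `HorizonlessMustDrain`, stub C1)

Crux stmt-FinalStateConjecture-9976, line `registered`, stub C1 `stub_incompletenessHidden_of_scriComplete`
("complete `𝓘⁺` (sojourn form) ⇒ every future-incomplete future-directed causal maximal geodesic has an event not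
visible from infinity").  C1 itself is blocked (no MGHD-boundary theory in the tree); this file proves the one reduction
the tree's causality does give, valid in EVERY Cauchy development: no event `q` has a whole final segment of a maximal
future-directed causal geodesic `γ` in its causal past (`exists_notMem_causalPast_of_isMaximalGeodesicOn`) — the
future-endless causal curve `γ|[t₀, ·)` would otherwise be imprisoned in the compact causal diamond `J⁺(γ t₀) ∩ J⁻(q)`
(Hawking–Ellis 1973, Prop. 6.6.6, Prop. 6.4.7).  Hence a totally visible incomplete geodesic — a counterexample to C1 —
is seen only from viewpoints receding along the complete rays (`exists_notMem_chronologicalPast_of_isMaximalGeodesicOn`):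
the "incompleteness at the ideal endpoint of a complete ray" shape.  Helper file (`--supports stmt-FinalStateConjecture-9976`);
no definitions, no named facts, no route item proved.

## References
* S. W. Hawking, G. F. R. Ellis, *The large scale structure of space-time*, CUP 1973, §6.4, Prop. 6.4.7 (p. 195);
  §6.6, Prop. 6.6.6 (p. 211). Key `HawkingEllis1973CUP`.
* B. O'Neill, *Semi-Riemannian geometry with applications to relativity*, Academic Press 1983, Ch. 14, Lemma 13
  (p. 407), Thm. 14.38 (p. 422). Key `ONeillSemiRiemannian1983`.
-/

set_option linter.dupNamespace false

noncomputable section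

open Set Filter Function Literature.Geometry.Lorentzian
open scoped Manifold ContDiff Topology

namespace Summit.FinalStateConjecture.FinalStateConjecture.Theorems.BondiDrainDispersalHorizonlessMustDrain

section NoSingleViewpoint

universe u

variable {n : ℕ} {X : Type u} [TopologicalSpace X] [ChartedSpace (EuclideanSpace ℝ (Fin n)) X]
  [IsManifold (𝓡 n) ∞ X] [ConnectedSpace X] {D : InitialDataSet (𝓡 n) X}

/-- **No event of a Cauchy development has a final segment of a maximal future-directed causal
geodesic in its causal past.**  If `γ` is a maximal geodesic of the Levi-Civita connection on `dom`
with future-directed causal velocity throughout, then for every event `q` and every `t₀ ∈ dom` there is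
`t ∈ dom`, `t ≥ t₀`, with `γ t ∉ J⁻(q)`: otherwise the future-endless causal curve `γ|[t₀, ·)` would be
imprisoned in the compact causal diamond `J⁺(γ t₀) ∩ J⁻(q)` (Hawking–Ellis 1973, Prop. 6.6.6 and
Prop. 6.4.7; O'Neill 1983, Ch. 14, Lemma 13 and Thm. 14.38).  In particular a totally visible
future-incomplete geodesic is never seen from ONE event: its viewpoints recede along the complete rays.
[cite: HawkingEllis1973CUP, §6.4, Prop. 6.4.7 (p. 195)] -/
theorem exists_notMem_causalPast_of_isMaximalGeodesicOn (𝒟 : CauchyDevelopment D)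
    [𝒟.metric.HasLeviCivita] {γ : ℝ → 𝒟.carrier} {dom : Set ℝ}
    (hγ : IsMaximalGeodesicOn 𝒟.metric.leviCivita γ dom)
    (hvel : ∀ t ∈ dom, 𝒟.metric.IsCausal (velocity (𝓡 (n + 1)) γ t) ∧
      𝒟.timeOrientation.IsFutureDirected (velocity (𝓡 (n + 1)) γ t))
    (q : 𝒟.carrier) {t₀ : ℝ} (ht₀ : t₀ ∈ dom) :
    ∃ t ∈ dom, t₀ ≤ t ∧ γ t ∉ 𝒟.metric.causalPast 𝒟.timeOrientation {q} := by
  have hk1 : (((1 : ℕ∞) : ℕ∞ω)) + 1 ≤ ∞ := by exact_mod_cast le_top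
  have hkT : (((⊤ : ℕ∞) : ℕ∞ω)) + 1 ≤ ∞ := by exact_mod_cast le_top
  haveI : CovariantDerivative.ContMDiffCovariantDerivative 𝒟.metric.leviCivita 1 :=
    ⟨𝒟.metric.isLocallyContMDiff_leviCivita_holds 1 hk1 univ isOpen_univ⟩
  haveI : CovariantDerivative.ContMDiffCovariantDerivative 𝒟.metric.leviCivita (⊤ : ℕ∞) :=
    ⟨𝒟.metric.isLocallyContMDiff_leviCivita_holds ⊤ hkT univ isOpen_univ⟩
  -- `γ` is a future causal curve on `dom`, future endless (maximal with nonzero velocity)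
  have hcurve : 𝒟.metric.IsFutureCausalCurveOn 𝒟.timeOrientation γ dom := fun t ht ↦
    ⟨IsGeodesicOn.mdifferentiableAt_holds hγ.isGeodesicOn ht, (hvel t ht).2⟩
  have hend : IsFutureEndless γ dom :=
    StubNoHorizonOfFutureNullComplete.isFutureEndless_of_isMaximalGeodesicOn hγ
      (fun t ht ↦ (hvel t ht).1.2) ht₀
  -- non-imprisonment in the compact causal diamond `J⁺(γ t₀) ∩ J⁻(q)`
  have hK := 𝒟.isCompact_causalDiamond (γ t₀) q
  have hn2 : (2 : ℕ∞ω) ≤ ∞ := WithTop.coe_le_coe.2 le_top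
  obtain ⟨t₁, ht₁, hout⟩ := LorentzianMetric.IsStronglyCausal.exists_forall_notMem hn2
    𝒟.isStronglyCausal hK hγ.2.1 hcurve hend
  refine ⟨max t₀ t₁, ?_, le_max_left _ _, fun hq ↦ ?_⟩
  · rcases le_total t₀ t₁ with h | h
    · rwa [max_eq_right h]
    · rwa [max_eq_left h]
  have hmem : max t₀ t₁ ∈ dom := by
    rcases le_total t₀ t₁ with h | h
    · rwa [max_eq_right h]
    · rwa [max_eq_left h]
  refine hout _ hmem (le_max_right _ _) ⟨?_, hq⟩
  exact (hcurve.mono (hγ.2.1.out ht₀ hmem)).apply_mem_causalFuture_apply_left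
    ⟨le_max_left _ _, le_rfl⟩

/-- **Receding viewpoints.**  For a maximal future-directed causal geodesic `γ` of a Cauchy development,
every event `x` (e.g. any point `δ s` of a complete normalised null ray) fails to have some later event of
`γ` in its chronological past: `∃ t ∈ dom, t ≥ t₀, γ t ∉ I⁻(x)`.  So if every event of a future-incomplete
`γ` is visible from infinity, the witnessing parameters along the complete rays are unbounded — the
"incompleteness seen ever later" shape. [folklore] -/
theorem exists_notMem_chronologicalPast_of_isMaximalGeodesicOn (𝒟 : CauchyDevelopment D)
    [𝒟.metric.HasLeviCivita] {γ : ℝ → 𝒟.carrier} {dom : Set ℝ}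
    (hγ : IsMaximalGeodesicOn 𝒟.metric.leviCivita γ dom)
    (hvel : ∀ t ∈ dom, 𝒟.metric.IsCausal (velocity (𝓡 (n + 1)) γ t) ∧
      𝒟.timeOrientation.IsFutureDirected (velocity (𝓡 (n + 1)) γ t))
    (x : 𝒟.carrier) {t₀ : ℝ} (ht₀ : t₀ ∈ dom) :
    ∃ t ∈ dom, t₀ ≤ t ∧ γ t ∉ 𝒟.metric.chronologicalPast 𝒟.timeOrientation {x} := by
  obtain ⟨t, ht, h0, hJ⟩ := exists_notMem_causalPast_of_isMaximalGeodesicOn 𝒟 hγ hvel x ht₀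
  exact ⟨t, ht, h0, fun hI ↦
    hJ (LorentzianMetric.chronologicalFuture_subset_causalFuture 𝒟.metric 𝒟.timeOrientation.reverse {x} hI)⟩

end NoSingleViewpoint

/-- **Registered glue stub `stub_noSingleViewpoint`** of crux stmt-FinalStateConjecture-9976 (line `registered`,
censorship tier of lead c4): the `3 + 1`-dimensional, `X : Type` instance of
`exists_notMem_causalPast_of_isMaximalGeodesicOn` — in every Cauchy development no event has a final segment of a
maximal future-directed causal geodesic in its causal past. Hawking–Ellis 1973, Prop. 6.4.7 and Prop. 6.6.6.
[cite: HawkingEllis1973CUP, §6.4, Prop. 6.4.7 (p. 195)] -/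
theorem stub_noSingleViewpoint : open scoped Manifold in ∀ (X : Type) [TopologicalSpace X] [ChartedSpace Literature.Geometry.Lorentzian.E3 X] [IsManifold (𝓡 3) ((⊤ : ℕ∞) : WithTop ℕ∞) X] [ConnectedSpace X] (D : Literature.Geometry.Lorentzian.InitialDataSet (𝓡 3) X) (𝒟 : Literature.Geometry.Lorentzian.CauchyDevelopment D) [𝒟.metric.HasLeviCivita] (γ : ℝ → 𝒟.carrier) (dom : Set ℝ), Literature.Geometry.Lorentzian.IsMaximalGeodesicOn 𝒟.metric.leviCivita γ dom → (∀ t ∈ dom, 𝒟.metric.IsCausal (Literature.Geometry.Lorentzian.velocity (𝓡 4) γ t) ∧ 𝒟.timeOrientation.IsFutureDirected (Literature.Geometry.Lorentzian.velocity (𝓡 4) γ t)) → ∀ (x : 𝒟.carrier), ∀ t₀ ∈ dom, ∃ t ∈ dom, t₀ ≤ t ∧ γ t ∉ 𝒟.metric.causalPast 𝒟.timeOrientation {x} :=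
  fun _ _ _ _ _ _ 𝒟 _ _ _ hγ hvel x _ ht₀ ↦ exists_notMem_causalPast_of_isMaximalGeodesicOn 𝒟 hγ hvel x ht₀

end Summit.FinalStateConjecture.FinalStateConjecture.Theorems.BondiDrainDispersalHorizonlessMustDrain

end
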